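import Summits.KontsevichZagierPeriods.KontsevichZagierPeriods.Theses.HurwitzMicroSectors
import Summits.KontsevichZagierPeriods.KontsevichZagierPeriods.Theorems.HurwitzMicroSectorsNormalFormPrinciplePiBoxTransfer
import Summits.KontsevichZagierPeriods.KontsevichZagierPeriods.Theorems.HurwitzMicroSectorsNormalFormPrincipleVariants2239
import Summits.KontsevichZagierPeriods.KontsevichZagierPeriods.Theorems.HurwitzMicroSectorsNormalFormPrincipleVariants2348

/-! TTRL-lite variant V2324 of stmt-KontsevichZagierPeriods-3869

Variant V2324 = `stub_boxRigidity` (BoxRigidity: two box-rational representations — domain the open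
unit box, integrand `p/q` over `ℚ` — with equal values are KZ-equivalent) under the JOINT small-case
move `bound_nat:m≤8; bound_nat:m'≤3` (hypotheses in the variant's order `m' ≤ 3 → m ≤ 8`). Verdict of
the attempt seat: **open** — this file is the exact-strength certificate, not a proof of the variant.
As for every joint bound (`boxRigidityLe_iff_boxVanishing`, file `…Variants2239`: `m ≤ j, m' ≤ k` is
BoxVanishing in the single dimension `max j k`), V2324 is EQUIVALENT to **BoxVanishing in dimension
`8`** — every box-rational representation on `(0,1)⁸` of value `0` is a Kontsevich–Zagier relation,
i.e. Conjecture 1 for box-rational periods of dimension `8`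
(`stub_boxRigidity_var2324_iff_boxVanishing_eight`: `⇒` compare with the zero representation on the
`0`-box; `⇐` pad both sides to the `8`-box by unit intervals, subtract on the common box, value `0` by
soundness), equivalently to BoxRigidity with BOTH dimensions `≤ 8`
(`stub_boxRigidity_var2324_iff_boxRigidityLe_eight`: the bound `m' ≤ 3` is idle next to `m ≤ 8`), and
to the recorded-open sibling V2348 (`m ≤ 8 → m' ≤ 2`, `stub_boxRigidity_var2324_iff_var2348`: the two
variants have literally the same strength). By monotonicity of BoxVanishing (`boxVanishing_mono`)
V2324 gives BoxVanishing in every dimension `≤ 8` (`boxVanishingLe_eight_of_stub_boxRigidity_var2324`)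
and hence every jointly bounded sibling with `max j k ≤ 8` (`boxRigidityLe_of_stub_boxRigidity_var2324`)
— in particular the recorded-open BoxVanishing(`2`) (V2338: Catalan's `G`, `π log 2`, `log² 2`,
`Li₂`/Clausen values against `ℚ`) and BoxVanishing(`3`) (V2239/V2339/V2349/V2350: e.g.
"`ζ(3) ∈ ℚ + ℚπ²` ⇒ the corresponding box-rational representations are KZ-equivalent"); so V2324 is
open a fortiori. On the other side `KontsevichZagierPeriods → V2324`
(`stub_boxRigidity_var2324_of_statement`), so a refutation of the variant would refute Conjecture 1
for the tree's calculus (no invariant of `KZ.relations` beyond `eval` is known). The proved two-sided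
frontier stays `max j k ≤ 1` (`boxRigidityLe_of_max_le_one`, file `…Variants2340`, and the slice
`stub_boxRigidity_var2229_slice_le_one`, file `…Variants2229`, Baker); dimension `2` is the first open one.
Source: M. Kontsevich, D. Zagier, *Periods* (2001), §1.2 Conjecture 1 and rules 1)–3).
Pure proof file, no definitions. -/

-- `Summit.<Summit>.<Problem>` is the tree's mandated summit-side namespace (CONVENTIONS §2); for this
-- single-conjunct summit the two coincide, so the duplicate is deliberate.
set_option linter.dupNamespace false

noncomputable section

namespace Summit.KontsevichZagierPeriods.KontsevichZagierPeriods.Theorems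

open MeasureTheory Set
open Literature.NumberTheory.Transcendental Literature.NumberTheory.Transcendental.KZ
open Summit.KontsevichZagierPeriods.KontsevichZagierPeriods.Theses.HurwitzMicroSectors
open Summit.KontsevichZagierPeriods.HurwitzMicroSectors.NormalFormPrinciple.PiBox

/-! ## The variant V2324: Conjecture 1 for box-rational periods of dimension 8 -/

/-- **V2324 ⟺ BoxVanishing in dimension `8`** (every box-rational representation on `(0,1)⁸` of value
`0` is a relation): `⇒` compare a box-rational representation on `(0,1)⁸` of value `0` (left slot,
`m = 8`) with the zero representation on the `0`-box (right slot, `m' = 0 ≤ 3`), itself a relation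
(`boxVanishing_of_boxRigidityLe`); `⇐` pad both representations to `(0,1)⁸` and subtract on the common
box, value `0` by soundness (`boxRigidityLe_of_boxVanishing`). The variant's hypothesis order
`m' ≤ 3 → m ≤ 8` is exactly the one of `boxRigidityLe_iff_boxVanishing 8 3`.
[cite: KontsevichZagier2001, §1.2 Conjecture 1] -/
theorem stub_boxRigidity_var2324_iff_boxVanishing_eight :
    (∀ (m m' : ℕ) (N : IntegralRep m) (N' : IntegralRep m'), m' ≤ 3 → m ≤ 8 → N.domain = {x | ∀ i, x i ∈ Set.Ioo (0:ℝ) 1} → N.IsRational → N'.domain = {x | ∀ i, x i ∈ Set.Ioo (0:ℝ) 1} → N'.IsRational → N.value = N'.value → Equivalent N N') ↔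
    (∀ N : IntegralRep 8, N.domain = {x | ∀ i, x i ∈ Set.Ioo (0:ℝ) 1} → N.IsRational →
      N.value = 0 → of N ∈ relations) :=
  ⟨fun h => boxVanishing_of_boxRigidityLe (j := 8) (k := 3) (K := 8) le_rfl h,
    fun hvan => boxRigidityLe_of_boxVanishing (j := 8) (k := 3) (K := 8) le_rfl (by norm_num) hvan⟩

/-- **V2324 ⇒ BoxVanishing in every dimension `≤ 8`** (monotonicity of BoxVanishing along padding,
`boxVanishing_mono`): in particular the recorded-open BoxVanishing(`2`) (V2338), BoxVanishing(`3`)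
(V2239, V2339, V2349, V2350), BoxVanishing(`≤ 4`) (V2341), BoxVanishing(`≤ 5`) (V2343) and
BoxVanishing(`≤ 6`) (V2345, V2346). [cite: KontsevichZagier2001, §1.2 Conjecture 1] -/
theorem boxVanishingLe_eight_of_stub_boxRigidity_var2324
    (h : ∀ (m m' : ℕ) (N : IntegralRep m) (N' : IntegralRep m'), m' ≤ 3 → m ≤ 8 → N.domain = {x | ∀ i, x i ∈ Set.Ioo (0:ℝ) 1} → N.IsRational → N'.domain = {x | ∀ i, x i ∈ Set.Ioo (0:ℝ) 1} → N'.IsRational → N.value = N'.value → Equivalent N N') :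
    ∀ (m : ℕ) (N : IntegralRep m), m ≤ 8 → N.domain = {x | ∀ i, x i ∈ Set.Ioo (0:ℝ) 1} →
      N.IsRational → N.value = 0 → of N ∈ relations :=
  fun _ N hm => boxVanishing_mono hm (stub_boxRigidity_var2324_iff_boxVanishing_eight.1 h) N

/-- **V2324 ⇒ BoxRigidity(`m ≤ j`, `m' ≤ k`) whenever `max j k ≤ 8`** (pad both sides to `(0,1)⁸`,
subtract, soundness: `boxRigidityLe_of_boxVanishing` with `K = 8`); so V2324 dominates every jointly
bounded sibling of level `≤ 8` and is open a fortiori. [cite: KontsevichZagier2001, §1.2 Conjecture 1] -/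
theorem boxRigidityLe_of_stub_boxRigidity_var2324 (j k : ℕ) (hjk : max j k ≤ 8)
    (h : ∀ (m m' : ℕ) (N : IntegralRep m) (N' : IntegralRep m'), m' ≤ 3 → m ≤ 8 → N.domain = {x | ∀ i, x i ∈ Set.Ioo (0:ℝ) 1} → N.IsRational → N'.domain = {x | ∀ i, x i ∈ Set.Ioo (0:ℝ) 1} → N'.IsRational → N.value = N'.value → Equivalent N N') :
    ∀ (m m' : ℕ) (N : IntegralRep m) (N' : IntegralRep m'), m' ≤ k → m ≤ j →
      N.domain = {x | ∀ i, x i ∈ Set.Ioo (0:ℝ) 1} → N.IsRational →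
      N'.domain = {x | ∀ i, x i ∈ Set.Ioo (0:ℝ) 1} → N'.IsRational →
      N.value = N'.value → Equivalent N N' :=
  boxRigidityLe_of_boxVanishing (le_of_max_le_left hjk) (le_of_max_le_right hjk)
    (stub_boxRigidity_var2324_iff_boxVanishing_eight.1 h)

/-- **V2324 ⟺ BoxRigidity with both dimensions `≤ 8`**: the bound `m' ≤ 3` is idle next to `m ≤ 8`
(the honest strength of the variant: Conjecture 1 for all pairs of rational integrands over `ℚ` on the
open unit boxes of dimension at most `8`). [cite: KontsevichZagier2001, §1.2 Conjecture 1] -/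
theorem stub_boxRigidity_var2324_iff_boxRigidityLe_eight :
    (∀ (m m' : ℕ) (N : IntegralRep m) (N' : IntegralRep m'), m' ≤ 3 → m ≤ 8 → N.domain = {x | ∀ i, x i ∈ Set.Ioo (0:ℝ) 1} → N.IsRational → N'.domain = {x | ∀ i, x i ∈ Set.Ioo (0:ℝ) 1} → N'.IsRational → N.value = N'.value → Equivalent N N') ↔
    (∀ (m m' : ℕ) (N : IntegralRep m) (N' : IntegralRep m'), m' ≤ 8 → m ≤ 8 →
      N.domain = {x | ∀ i, x i ∈ Set.Ioo (0:ℝ) 1} → N.IsRational →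
      N'.domain = {x | ∀ i, x i ∈ Set.Ioo (0:ℝ) 1} → N'.IsRational →
      N.value = N'.value → Equivalent N N') :=
  ⟨fun h => boxRigidityLe_of_stub_boxRigidity_var2324 8 8 (by norm_num) h,
    fun h m m' N N' hm' hm => h m m' N N' (hm'.trans (by norm_num)) hm⟩

/-- **V2324 ⟺ the recorded-open sibling V2348** (`bound_nat:m≤8; bound_nat:m'≤2`, hypotheses read
`m ≤ 8 → m' ≤ 2`): both are BoxVanishing(`8`) — which bound `≤ 8` the idle slot carries, and in which
order the two hypotheses are read, does not change the strength. [cite: KontsevichZagier2001, §1.2 Conjecture 1] -/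
theorem stub_boxRigidity_var2324_iff_var2348 :
    (∀ (m m' : ℕ) (N : IntegralRep m) (N' : IntegralRep m'), m' ≤ 3 → m ≤ 8 → N.domain = {x | ∀ i, x i ∈ Set.Ioo (0:ℝ) 1} → N.IsRational → N'.domain = {x | ∀ i, x i ∈ Set.Ioo (0:ℝ) 1} → N'.IsRational → N.value = N'.value → Equivalent N N') ↔
    (∀ (m m' : ℕ) (N : IntegralRep m) (N' : IntegralRep m'), m ≤ 8 → m' ≤ 2 →
      N.domain = {x | ∀ i, x i ∈ Set.Ioo (0:ℝ) 1} → N.IsRational →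
      N'.domain = {x | ∀ i, x i ∈ Set.Ioo (0:ℝ) 1} → N'.IsRational →
      N.value = N'.value → Equivalent N N') :=
  stub_boxRigidity_var2324_iff_boxVanishing_eight.trans
    stub_boxRigidity_var2348_iff_boxVanishing_eight.symm

/-! ## The other side: the variant is implied by the Summit -/

/-- **The parent leaf ⇒ V2324** (the variant is a specialisation of `stub_boxRigidity`; the converse
is not claimed — the parent is BoxVanishing in ALL dimensions). [cite: KontsevichZagier2001, §1.2 Conjecture 1] -/
theorem stub_boxRigidity_var2324_of_parent
    (h : ∀ (m m' : ℕ) (N : IntegralRep m) (N' : IntegralRep m'), N.domain = {x | ∀ i, x i ∈ Set.Ioo (0:ℝ) 1} → N.IsRational → N'.domain = {x | ∀ i, x i ∈ Set.Ioo (0:ℝ) 1} → N'.IsRational → N.value = N'.value → Equivalent N N') :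
    ∀ (m m' : ℕ) (N : IntegralRep m) (N' : IntegralRep m'), m' ≤ 3 → m ≤ 8 → N.domain = {x | ∀ i, x i ∈ Set.Ioo (0:ℝ) 1} → N.IsRational → N'.domain = {x | ∀ i, x i ∈ Set.Ioo (0:ℝ) 1} → N'.IsRational → N.value = N'.value → Equivalent N N' :=
  fun m m' N N' _ _ => h m m' N N'

/-- **`KontsevichZagierPeriods ⇒ V2324`**: the variant is a special case of Conjecture 1 for the
tree's calculus (`leaves_of_statement`) — a refutation of the variant would refute the Summit.
[cite: KontsevichZagier2001, §1.2 Conjecture 1] -/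
theorem stub_boxRigidity_var2324_of_statement (h : _root_.KontsevichZagierPeriods) :
    ∀ (m m' : ℕ) (N : IntegralRep m) (N' : IntegralRep m'), m' ≤ 3 → m ≤ 8 → N.domain = {x | ∀ i, x i ∈ Set.Ioo (0:ℝ) 1} → N.IsRational → N'.domain = {x | ∀ i, x i ∈ Set.Ioo (0:ℝ) 1} → N'.IsRational → N.value = N'.value → Equivalent N N' :=
  stub_boxRigidity_var2324_of_parent (leaves_of_statement h).1

end Summit.KontsevichZagierPeriods.KontsevichZagierPeriods.Theorems
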